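import Summits.QuantumFields.BalabanUV.Beta.FP.PerfectPropagatorLegData

/-!
# `BalabanUV.Beta.FP.PerfectPropagatorLegDataProducts` — road «FP» for binder row D1, leaf (H2) of the horizontal route, row **H2-ASM-2** (H2V-DESIGN §4,
# R-FP-23; `LEAVES-FP.md` l.323; owner «GO, THIS SHAPE» l.23297), PART 3: the leg letters of `legP = Re PinfKer` in Mathlib's `fwdDiff` currency (the input
# shape of `FP/ExpLocalisedBubblePoint`) and THE TWO PRODUCT TRANSFERS H2-ASM-3 consumes — `P·Δ_μΔ_νP = c₄²·|x|⁻²·∂_μ∂_ν|x|⁻² + O(‖z‖∞⁻⁷)` (the `legW`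
# placement) and `Δ_iP·Δ_jP = c₄²·∂_i|x|⁻²·∂_j|x|⁻² + O(‖z‖∞⁻⁷)` (the `legWx` placement).

HONEST DEPENDENCY (page 1, mandatory): continuum YM on T⁴ ⇐ BetaPertH ∧ nine spine estimates (0/9 proved); BetaPertH ⇐ (D1) ∧ (D4) ∧ CAP+tail;
G-an2-4 gates asym, D1 and NE2/3/4.  HONEST FRAMING (cell contract, verbatim): «discharging `BetaPertH` makes Bałaban's UV stability UNCONDITIONAL —
a real constructive-QFT result; it is NOT the continuum limit and NOT the Clay problem.»  THIS MODULE DISCHARGES NOTHING of the wall: [folklore] bookkeeping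
(`|PQ − pq| ≤ |P − p||Q| + |p||Q − q|`) over PART 2's letters (L1)–(L3) and dictionary (D0)–(D2) and an3's continuum leg bounds `BubbleTransfer.freeLeg.lead` ∕
`abs_grad_cont_le`.  0 def; 0 `def … : Prop`; nothing cited; 0 sorry; constants existential-grade; 0 estimates of Bałaban's CONSTRAINED kernels; 0∕4 row-D1
binders; NEVER «G-an2-4 closed»; NOT `hgerm`, NOT D1, NOT BetaPertH, NOT continuum, NOT Clay.

ABSOLUTE RULE (cell charter, verbatim): «No internally-minted statement may enter as a cited fact. Every hypothesis is either kernel-proved in this package or a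
verbatim quotation of a PUBLISHED theorem with page reference. The manuscript(s) under audit are NOT citable for their own disputed steps — they are the thing
under adjudication; programme-internal (2001/route/tribunal) claims are never citable.»

WHAT (`z ∈ ℤ⁴`, `s = supNorm z`, `X = toReal z`, `e_μ = Pi.single μ 1`):
* §4 [our object] `abs_fwdDiff_legP_le`, `abs_fwdDiff₂_legP_le`, `abs_fwdDiff₃_legP_le` — (L1)–(L3) as `|Δ_[e_μ] …|` bounds.
* §5 [our object] `A1P∕A2P∕D0P∕D1P∕D2P_nonneg`, `abs_dict0_le` (`|[α=β]c₄|X|⁻²| ≤ c₄∕s²`), `abs_dict1_le` (`≤ 2c₄∕s³`); **(P1) `abs_legP_mul_diff2_sub_le`** (`4 ≤ s`: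
  `|legP α β z·Δ_μΔ_ν legP γ δ z − ([α=β]c₄|X|⁻²)([γ=δ]c₄∂_μ∂_ν|X|⁻²)| ≤ (D0P·A2P + c₄·D2P)∕s⁷`); **(P2) `abs_legP_diff_mul_diff_sub_le`** (`2 ≤ s`:
  `|Δ_i legP α β z·Δ_j legP γ δ z − ([α=β]c₄∂_i|X|⁻²)([γ=δ]c₄∂_j|X|⁻²)| ≤ (D1P·A1P + 2c₄·D1P)∕s⁷`).

Provenance: binder row D1 formalisation swarm, lineage beta-d1-formalise-leaf-01, gen 9 (prover-b2b-balaban-beta-d1-formalise-leaf-01-g9-0), 2026-08-20;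
road FP (owner b2b-balaban-beta-d1-p3, H2V-DESIGN f78878bd5f8d2d18, GO l.23297), row H2-ASM-2; INTENT ∕ CLAIM journal l.23258.
-/

noncomputable section

namespace Summit.QuantumFields.BalabanUV.Beta.FP.PerfectPropagatorLegDataProducts

open Finset fwdDiff
open scoped BigOperators
open Literature.MathematicalPhysics.QuantumFieldTheory.Balaban1983to89.Beta
open Literature.MathematicalPhysics.QuantumFieldTheory.Balaban1983to89.Beta.TransverseStructure
open Literature.MathematicalPhysics.QuantumFieldTheory.Balaban1983to89.Beta.DyadicShell (Pt toReal supNorm supNorm_eq_zero_iff supNorm_pos norm_toReal)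
open Literature.MathematicalPhysics.QuantumFieldTheory.Balaban1983to89.Beta.BubbleTransfer (Leg c4 c4_pos unitVec invSq d1InvSq hessInvSq freeLeg freeLeg_a
  freeLeg_ℓ abs_grad_cont_le)
open Literature.MathematicalPhysics.QuantumFieldTheory.Balaban1983to89.Beta.TwoPowerLegs (TwoPower free)
open Summit.QuantumFields.BalabanUV.Beta.FP.PerfectPropagatorKernel (CKB CB0 CB0_nonneg)
open Summit.QuantumFields.BalabanUV.Beta.FP.PerfectPropagatorKernelLegs (CKB_nonneg)
open Summit.QuantumFields.BalabanUV.Beta.FP.PerfectPropagatorKernelGraded (CKB₂ CKB₃ CKB₂_nonneg CKB₃_nonneg)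
open Summit.QuantumFields.BalabanUV.Beta.FP.PerfectPropagatorLegDataFree (B3free B3free_nonneg)
open Summit.QuantumFields.BalabanUV.Beta.FP.PerfectPropagatorLegData

/-! ## §4 The letters in the `fwdDiff` currency of `FP/ExpLocalisedBubblePoint` -/

/-- [our object] (L1) as `|Δ_[e_μ] (legP α β) z| ≤ A1P∕(‖z‖∞+1)³`. -/
theorem abs_fwdDiff_legP_le (α β μ : Fin (3 + 1)) (z : Pt) :
    |Δ_[(Pi.single μ 1 : Pt)] (legP α β) z| ≤ A1P / ((supNorm z : ℝ) + 1) ^ 3 := by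
  simp only [fwdDiff]
  exact abs_legP_diff_le α β μ z

/-- [our object] (L2) as `|Δ_[e_μ] (Δ_[e_ν] (legP α β)) z| ≤ A2P∕(‖z‖∞+1)⁴`. -/
theorem abs_fwdDiff₂_legP_le (α β μ ν : Fin (3 + 1)) (z : Pt) :
    |Δ_[(Pi.single μ 1 : Pt)] (Δ_[(Pi.single ν 1 : Pt)] (legP α β)) z| ≤ A2P / ((supNorm z : ℝ) + 1) ^ 4 := by
  have h := abs_legP_diff2_le α β μ ν z
  have e : Δ_[(Pi.single μ 1 : Pt)] (Δ_[(Pi.single ν 1 : Pt)] (legP α β)) z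
      = legP α β (z + Pi.single μ 1 + Pi.single ν 1) - legP α β (z + Pi.single μ 1) - legP α β (z + Pi.single ν 1) + legP α β z := by
    simp only [fwdDiff]; ring
  rw [e]; exact h

/-- [our object] (L3) as `|Δ_[e_κ] (Δ_[e_μ] (Δ_[e_ν] (legP α β))) z| ≤ A3P∕(‖z‖∞+1)⁵`. -/
theorem abs_fwdDiff₃_legP_le (α β κ μ ν : Fin (3 + 1)) (z : Pt) :
    |Δ_[(Pi.single κ 1 : Pt)] (Δ_[(Pi.single μ 1 : Pt)] (Δ_[(Pi.single ν 1 : Pt)] (legP α β))) z| ≤ A3P / ((supNorm z : ℝ) + 1) ^ 5 := by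
  have h := abs_legP_diff3_le α β κ μ ν z
  have e : Δ_[(Pi.single κ 1 : Pt)] (Δ_[(Pi.single μ 1 : Pt)] (Δ_[(Pi.single ν 1 : Pt)] (legP α β))) z
      = legP α β (z + Pi.single κ 1 + Pi.single μ 1 + Pi.single ν 1) - legP α β (z + Pi.single κ 1 + Pi.single μ 1)
        - legP α β (z + Pi.single κ 1 + Pi.single ν 1) - legP α β (z + Pi.single μ 1 + Pi.single ν 1)
        + legP α β (z + Pi.single κ 1) + legP α β (z + Pi.single μ 1) + legP α β (z + Pi.single ν 1) - legP α β z := by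
    simp only [fwdDiff]; ring
  rw [e]; exact h

/-! ## §5 The two product transfers of H2-ASM-3 (the `legW`∕`legWx` placements) -/

/-- [folklore] `0 ≤ A1P`. -/
theorem A1P_nonneg : 0 ≤ A1P := by
  unfold A1P; have := free.nonneg_U; have := free.Bgrad_nonneg; have := c4_pos; have := CKB_nonneg hd3; have := CB0_nonneg 3; positivity

/-- [folklore] `0 ≤ A2P`. -/
theorem A2P_nonneg : 0 ≤ A2P := by
  unfold A2P; have := free.nonneg_U; have := B3free_nonneg; have := c4_pos; have := CKB₃_nonneg hd3; have := CB0_nonneg 3; positivity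

/-- [folklore] `0 ≤ D0P`. -/
theorem D0P_nonneg : 0 ≤ D0P := by unfold D0P; have := free.nonneg_B; have := CKB_nonneg hd3; positivity

/-- [folklore] `0 ≤ D1P`. -/
theorem D1P_nonneg : 0 ≤ D1P := by
  unfold D1P; have := B3free_nonneg; have := c4_pos; have := CKB₂_nonneg hd3; have := CB0_nonneg 3; positivity

/-- [folklore] `0 ≤ D2P`. -/
theorem D2P_nonneg : 0 ≤ D2P := by
  unfold D2P; have := B3free_nonneg; have := c4_pos; have := CKB₃_nonneg hd3; have := CB0_nonneg 3; positivity

/-- [folklore] the continuum value leg `|[α=β]·c₄|X|⁻²| ≤ c₄∕‖z‖∞²` (`z ≠ 0`). -/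
theorem abs_dict0_le (α β : Fin (3 + 1)) {z : Pt} (hz : z ≠ 0) :
    |(if α = β then c4 * invSq (toReal z) else 0)| ≤ c4 / (supNorm z : ℝ) ^ 2 := by
  by_cases hab : α = β
  · rw [if_pos hab]
    have h := freeLeg.lead z hz
    have hA : freeLeg.A = c4 := rfl
    rw [freeLeg_ℓ, freeLeg_a, hA] at h
    exact h
  · rw [if_neg hab, abs_zero]; have := c4_pos; positivity

/-- [folklore] the continuum gradient leg `|[α=β]·c₄∂_i|X|⁻²| ≤ 2c₄∕‖z‖∞³` (`z ≠ 0`). -/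
theorem abs_dict1_le (α β i : Fin (3 + 1)) {z : Pt} (hz : z ≠ 0) :
    |(if α = β then c4 * d1InvSq i (toReal z) else 0)| ≤ 2 * c4 / (supNorm z : ℝ) ^ 3 := by
  by_cases hab : α = β
  · rw [if_pos hab]; exact abs_grad_cont_le i hz
  · rw [if_neg hab, abs_zero]; have := c4_pos; positivity

/-- [our object] **PRODUCT TRANSFER (P1), the `legW` placement** (`4 ≤ ‖z‖∞`, every `α β γ δ μ ν`):
`|legP α β z · Δ_μΔ_ν legP γ δ z − ([α=β]c₄|X|⁻²)·([γ=δ]c₄∂_μ∂_ν|X|⁻²)| ≤ (D0P·A2P + c₄·D2P)∕‖z‖∞⁷` — i.e. `P·Δ_μΔ_νP = c₄²·invSq·hessInvSq + O(‖z‖∞⁻⁷)`. -/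
theorem abs_legP_mul_diff2_sub_le (α β γ δ μ ν : Fin (3 + 1)) {z : Pt} (hz : 4 ≤ supNorm z) :
    |legP α β z * (legP γ δ (z + Pi.single μ 1 + Pi.single ν 1) - legP γ δ (z + Pi.single μ 1) - legP γ δ (z + Pi.single ν 1) + legP γ δ z)
        - (if α = β then c4 * invSq (toReal z) else 0) * (if γ = δ then c4 * hessInvSq μ ν (toReal z) else 0)|
      ≤ (D0P * A2P + c4 * D2P) / (supNorm z : ℝ) ^ 7 := by
  have hz0 : z ≠ 0 := by intro h; rw [h, supNorm_eq_zero_iff.mpr rfl] at hz; omega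
  have hs4 : (4 : ℝ) ≤ supNorm z := by exact_mod_cast hz
  have hspos : (0 : ℝ) < supNorm z := by linarith
  set s : ℝ := (supNorm z : ℝ) with hsdef
  set P := legP α β z
  set Q := legP γ δ (z + Pi.single μ 1 + Pi.single ν 1) - legP γ δ (z + Pi.single μ 1) - legP γ δ (z + Pi.single ν 1) + legP γ δ z
  set p := (if α = β then c4 * invSq (toReal z) else 0)
  set q := (if γ = δ then c4 * hessInvSq μ ν (toReal z) else 0)
  have hP : |P - p| ≤ D0P / s ^ 3 := abs_legP_sub_invSq_le α β hz0
  have hQ : |Q| ≤ A2P / s ^ 4 := (abs_legP_diff2_le γ δ μ ν z).trans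
    (div_le_div_of_nonneg_left A2P_nonneg (by positivity) (pow_le_pow_left₀ hspos.le (by linarith) 4))
  have hp : |p| ≤ c4 / s ^ 2 := abs_dict0_le α β hz0
  have hq : |Q - q| ≤ D2P / s ^ 5 := abs_legP_diff2_sub_hess_le γ δ μ ν hz
  have e : P * Q - p * q = (P - p) * Q + p * (Q - q) := by ring
  rw [e]
  have h1 : |(P - p) * Q| ≤ (D0P / s ^ 3) * (A2P / s ^ 4) := by
    rw [abs_mul]; exact mul_le_mul hP hQ (abs_nonneg _) (div_nonneg D0P_nonneg (by positivity))
  have h2 : |p * (Q - q)| ≤ (c4 / s ^ 2) * (D2P / s ^ 5) := by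
    rw [abs_mul]; exact mul_le_mul hp hq (abs_nonneg _) (div_nonneg c4_pos.le (by positivity))
  calc |(P - p) * Q + p * (Q - q)| ≤ |(P - p) * Q| + |p * (Q - q)| := abs_add_le _ _
    _ ≤ (D0P / s ^ 3) * (A2P / s ^ 4) + (c4 / s ^ 2) * (D2P / s ^ 5) := add_le_add h1 h2
    _ = (D0P * A2P + c4 * D2P) / s ^ 7 := by field_simp

/-- [our object] **PRODUCT TRANSFER (P2), the `legWx` placement** (`2 ≤ ‖z‖∞`, every `α β γ δ i j`):
`|Δ_i legP α β z · Δ_j legP γ δ z − ([α=β]c₄∂_i|X|⁻²)·([γ=δ]c₄∂_j|X|⁻²)| ≤ (D1P·A1P + 2c₄·D1P)∕‖z‖∞⁷` — i.e. `Δ_iP·Δ_jP = c₄²·d1InvSq·d1InvSq + O(‖z‖∞⁻⁷)`. -/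
theorem abs_legP_diff_mul_diff_sub_le (α β γ δ i j : Fin (3 + 1)) {z : Pt} (hz : 2 ≤ supNorm z) :
    |(legP α β (z + Pi.single i 1) - legP α β z) * (legP γ δ (z + Pi.single j 1) - legP γ δ z)
        - (if α = β then c4 * d1InvSq i (toReal z) else 0) * (if γ = δ then c4 * d1InvSq j (toReal z) else 0)|
      ≤ (D1P * A1P + 2 * c4 * D1P) / (supNorm z : ℝ) ^ 7 := by
  have hz0 : z ≠ 0 := by intro h; rw [h, supNorm_eq_zero_iff.mpr rfl] at hz; omega
  have hs2 : (2 : ℝ) ≤ supNorm z := by exact_mod_cast hz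
  have hspos : (0 : ℝ) < supNorm z := by linarith
  set s : ℝ := (supNorm z : ℝ) with hsdef
  set P := legP α β (z + Pi.single i 1) - legP α β z
  set Q := legP γ δ (z + Pi.single j 1) - legP γ δ z
  set p := (if α = β then c4 * d1InvSq i (toReal z) else 0)
  set q := (if γ = δ then c4 * d1InvSq j (toReal z) else 0)
  have hP : |P - p| ≤ D1P / s ^ 4 := abs_legP_diff_sub_d1_le α β i hz
  have hQ : |Q| ≤ A1P / s ^ 3 := (abs_legP_diff_le γ δ j z).trans
    (div_le_div_of_nonneg_left A1P_nonneg (by positivity) (pow_le_pow_left₀ hspos.le (by linarith) 3))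
  have hp : |p| ≤ 2 * c4 / s ^ 3 := abs_dict1_le α β i hz0
  have hq : |Q - q| ≤ D1P / s ^ 4 := abs_legP_diff_sub_d1_le γ δ j hz
  have e : P * Q - p * q = (P - p) * Q + p * (Q - q) := by ring
  rw [e]
  have h1 : |(P - p) * Q| ≤ (D1P / s ^ 4) * (A1P / s ^ 3) := by
    rw [abs_mul]; exact mul_le_mul hP hQ (abs_nonneg _) (div_nonneg D1P_nonneg (by positivity))
  have h2 : |p * (Q - q)| ≤ (2 * c4 / s ^ 3) * (D1P / s ^ 4) := by
    rw [abs_mul]; exact mul_le_mul hp hq (abs_nonneg _) (div_nonneg (by have := c4_pos; positivity) (by positivity))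
  calc |(P - p) * Q + p * (Q - q)| ≤ |(P - p) * Q| + |p * (Q - q)| := abs_add_le _ _
    _ ≤ (D1P / s ^ 4) * (A1P / s ^ 3) + (2 * c4 / s ^ 3) * (D1P / s ^ 4) := add_le_add h1 h2
    _ = (D1P * A1P + 2 * c4 * D1P) / s ^ 7 := by field_simp

end Summit.QuantumFields.BalabanUV.Beta.FP.PerfectPropagatorLegDataProducts

end
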